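import Mathlib
import Literature.Probability.LatticeModels.TorusFourierWeightedConvolution
import HarnessLib

/-!
# Weighted `ℓ¹` norms of convolutions on the discrete torus, II: SUBADDITIVE (Leibniz) weights — the first moment of a
# convolution is LINEAR in each factor's first moment

Topic `Probability/LatticeModels`; sequel of `TorusFourierWeightedConvolution` (§3 there: Young's inequality for a SUBMULTIPLICATIVE
weight, `M_w(F∗G) ≤ M_w(F)·M_w(G)`).  For MOMENT weights the submultiplicative form `(1+|x|)(1+|y|)` overcounts by the cross term
`|x|·|y|`; the Leibniz split `|x + y| ≤ |x| + |y|` gives instead the LINEAR form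
`Σ_x |x̃|·‖(F∗G)(x)‖ ≤ M₁(F)·ℓ¹(G) + ℓ¹(F)·M₁(G)` — each factor's spread is multiplied by the OTHER factor's mass, never by its spread
(cell gate-hubbard-kl, K3 engine-flow child: the space row of a two-leg kernel containing a quadratic vertex of large position spread but
small mass; Benfatto–Giuliani–Mastropietro 2003 §1.2 (the counterterm kernel's decay), 2006 §3 (3.2)–(3.3)):

* §1 **`sum_mul_norm_conv_le_of_le_add`** — two-weight master form: if `w(x + y) ≤ u(x) + v(y)` (`w ≥ 0`) then
  `Σ_x w(x)‖Σ_y F(y)G(x−y)‖ ≤ (Σ u‖F‖)(Σ ‖G‖) + (Σ ‖F‖)(Σ v‖G‖)`; the subadditive case `sum_mul_norm_conv_le_of_subadditive`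
  (`u = v = w`); the inverse-transform forms `sum_mul_norm_torusFourierInv_mul_le_of_le_add/_of_subadditive` (moments of a product);
* §2 the linear moment weight `|x̃|₁ = Σ_i |x̃_i|` is non-negative, even and SUBADDITIVE (`sum_natAbs_valMinAbs_add_le`), and
  `1 + |x̃ + ỹ|₁ ≤ (1 + |x̃|₁) + |ỹ|₁` (`one_add_momentWt_add_le`); hence **`firstMoment_conv_le`**
  (`Σ_x |x̃|₁‖(F∗G)(x)‖ ≤ M₁(F)ℓ¹(G) + ℓ¹(F)M₁(G)`) and **`oneAddMoment_conv_le`**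
  (`Σ_x (1+|x̃|₁)‖(F∗G)(x)‖ ≤ (Σ(1+|x̃|₁)‖F‖)·ℓ¹(G) + ℓ¹(F)·M₁(G)`), plus the `torusFourierInv` product forms;
* §3 the same master/subadditive forms on ANY finite abelian group (`AddCommGroup.sum_mul_norm_conv_le_of_le_add/_of_subadditive`,
  `AddCommGroup.sum_norm_conv_le`); §4 the SPACE moment weight on the space-time grid `(ℤ/N) × (ℤ/L)²` (time ignored):
  `firstSpaceMoment_conv_le`, `oneAddSpaceMoment_conv_le` — the form the grid two-leg moment rows use.

Everything is proved; no definitions; no named facts.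

## Sources

G. Benfatto, A. Giuliani, V. Mastropietro, Ann. Henri Poincaré 4 (2003) 137–193, §1.2; Ann. Henri Poincaré 7 (2006) 809–898, §3 (3.2)–(3.3)
(`BenfattoGiulianiMastropietro2006`); S. Friedli, Y. Velenik, *Statistical Mechanics of Lattice Systems* (2017), §10.4 (`FriedliVelenik2017`).
-/

noncomputable section

open Finset Complex

namespace Literature.Probability.LatticeModels

variable {d L : ℕ} [NeZero L]

/-! ### §1 The two-weight (Leibniz) convolution inequality -/

/-- **Leibniz–Young on the torus, two-weight master form**: if `0 ≤ w` and `w(x + y) ≤ u(x) + v(y)` for all `x, y`, then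
`Σ_x w(x)‖Σ_y F(y)G(x − y)‖ ≤ (Σ_x u(x)‖F(x)‖)·(Σ_x ‖G(x)‖) + (Σ_x ‖F(x)‖)·(Σ_x v(x)‖G(x)‖)` — the weight goes to ONE factor at a time.
[cite: BenfattoGiulianiMastropietro2006, §3 (3.3)] -/
theorem sum_mul_norm_conv_le_of_le_add {w u v : TorusSite d L → ℝ} (hw0 : ∀ x, 0 ≤ w x) (hw : ∀ x y, w (x + y) ≤ u x + v y)
    (F G : TorusSite d L → ℂ) :
    ∑ x, w x * ‖∑ y, F y * G (x - y)‖ ≤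
      (∑ x, u x * ‖F x‖) * (∑ x, ‖G x‖) + (∑ x, ‖F x‖) * (∑ x, v x * ‖G x‖) := by
  calc ∑ x, w x * ‖∑ y, F y * G (x - y)‖
      ≤ ∑ x, ∑ y, (u y * ‖F y‖ * ‖G (x - y)‖ + ‖F y‖ * (v (x - y) * ‖G (x - y)‖)) := by
        refine sum_le_sum fun x _ => ?_
        calc w x * ‖∑ y, F y * G (x - y)‖ ≤ w x * ∑ y, ‖F y‖ * ‖G (x - y)‖ :=
              mul_le_mul_of_nonneg_left ((norm_sum_le _ _).trans (le_of_eq (sum_congr rfl fun y _ => norm_mul _ _))) (hw0 x)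
          _ = ∑ y, w x * (‖F y‖ * ‖G (x - y)‖) := by rw [mul_sum]
          _ ≤ ∑ y, (u y * ‖F y‖ * ‖G (x - y)‖ + ‖F y‖ * (v (x - y) * ‖G (x - y)‖)) := sum_le_sum fun y _ => by
              have hxy : w x ≤ u y + v (x - y) := by
                have h := hw y (x - y); rwa [add_sub_cancel] at h
              calc w x * (‖F y‖ * ‖G (x - y)‖) ≤ (u y + v (x - y)) * (‖F y‖ * ‖G (x - y)‖) :=
                    mul_le_mul_of_nonneg_right hxy (by positivity)
                _ = u y * ‖F y‖ * ‖G (x - y)‖ + ‖F y‖ * (v (x - y) * ‖G (x - y)‖) := by ring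
    _ = ∑ y, (u y * ‖F y‖ * ∑ x, ‖G (x - y)‖ + ‖F y‖ * ∑ x, v (x - y) * ‖G (x - y)‖) := by
        rw [sum_comm]
        refine sum_congr rfl fun y _ => ?_
        rw [sum_add_distrib, mul_sum, mul_sum]
    _ = ∑ y, (u y * ‖F y‖ * ∑ x, ‖G x‖ + ‖F y‖ * ∑ x, v x * ‖G x‖) := by
        refine sum_congr rfl fun y _ => ?_
        congr 2
        · exact Fintype.sum_equiv (Equiv.subRight y) _ _ fun x => rfl
        · exact Fintype.sum_equiv (Equiv.subRight y) _ _ fun x => rfl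
    _ = (∑ x, u x * ‖F x‖) * (∑ x, ‖G x‖) + (∑ x, ‖F x‖) * (∑ x, v x * ‖G x‖) := by
        rw [sum_add_distrib, sum_mul, sum_mul]

/-- **Leibniz–Young for a subadditive weight**: `0 ≤ w`, `w(x + y) ≤ w(x) + w(y)` give
`Σ_x w(x)‖(F∗G)(x)‖ ≤ M_w(F)·ℓ¹(G) + ℓ¹(F)·M_w(G)` — LINEAR in each factor's `w`-moment. [cite: BenfattoGiulianiMastropietro2006, §3 (3.3)] -/
theorem sum_mul_norm_conv_le_of_subadditive {w : TorusSite d L → ℝ} (hw0 : ∀ x, 0 ≤ w x) (hw : ∀ x y, w (x + y) ≤ w x + w y)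
    (F G : TorusSite d L → ℂ) :
    ∑ x, w x * ‖∑ y, F y * G (x - y)‖ ≤
      (∑ x, w x * ‖F x‖) * (∑ x, ‖G x‖) + (∑ x, ‖F x‖) * (∑ x, w x * ‖G x‖) :=
  sum_mul_norm_conv_le_of_le_add hw0 hw F G

/-- **Moments of a product, two-weight form**: `Σ_x w‖(fg)ˇ‖ ≤ (Σ u‖f̌‖)(Σ‖ǧ‖) + (Σ‖f̌‖)(Σ v‖ǧ‖)` whenever `0 ≤ w`, `w(x+y) ≤ u(x) + v(y)`.
[cite: BenfattoGiulianiMastropietro2006, §3 (3.3)] -/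
theorem sum_mul_norm_torusFourierInv_mul_le_of_le_add {w u v : TorusSite d L → ℝ} (hw0 : ∀ x, 0 ≤ w x)
    (hw : ∀ x y, w (x + y) ≤ u x + v y) (f g : TorusSite d L → ℂ) :
    ∑ x, w x * ‖torusFourierInv (fun k => f k * g k) x‖ ≤
      (∑ x, u x * ‖torusFourierInv f x‖) * (∑ x, ‖torusFourierInv g x‖) +
        (∑ x, ‖torusFourierInv f x‖) * (∑ x, v x * ‖torusFourierInv g x‖) := by
  simp_rw [torusFourierInv_mul f g]
  exact sum_mul_norm_conv_le_of_le_add hw0 hw _ _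

/-- **Moments of a product, subadditive weight**: `M_w((fg)ˇ) ≤ M_w(f̌)·ℓ¹(ǧ) + ℓ¹(f̌)·M_w(ǧ)`. [cite: BenfattoGiulianiMastropietro2006, §3 (3.3)] -/
theorem sum_mul_norm_torusFourierInv_mul_le_of_subadditive {w : TorusSite d L → ℝ} (hw0 : ∀ x, 0 ≤ w x)
    (hw : ∀ x y, w (x + y) ≤ w x + w y) (f g : TorusSite d L → ℂ) :
    ∑ x, w x * ‖torusFourierInv (fun k => f k * g k) x‖ ≤
      (∑ x, w x * ‖torusFourierInv f x‖) * (∑ x, ‖torusFourierInv g x‖) +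
        (∑ x, ‖torusFourierInv f x‖) * (∑ x, w x * ‖torusFourierInv g x‖) :=
  sum_mul_norm_torusFourierInv_mul_le_of_le_add hw0 hw f g

/-! ### §2 The linear moment weight `|x̃|₁ = Σ_i |x̃_i|` and the first-moment forms -/

omit [NeZero L] in
/-- The linear moment weight is non-negative. [cite: FriedliVelenik2017, §10.4] -/
theorem momentWt_nonneg (x : TorusSite d L) : 0 ≤ ∑ i, ((x i).valMinAbs.natAbs : ℝ) :=
  sum_nonneg fun _ _ => Nat.cast_nonneg _

omit [NeZero L] in
/-- **Subadditivity of the linear moment weight**: `Σ_i |(x + y)~_i| ≤ Σ_i |x̃_i| + Σ_i |ỹ_i|` (the centred representative minimises the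
absolute value). [cite: FriedliVelenik2017, §10.4] -/
theorem sum_natAbs_valMinAbs_add_le (x y : TorusSite d L) :
    ∑ i, (((x + y) i).valMinAbs.natAbs : ℝ) ≤ ∑ i, ((x i).valMinAbs.natAbs : ℝ) + ∑ i, ((y i).valMinAbs.natAbs : ℝ) := by
  rw [← sum_add_distrib]
  exact sum_le_sum fun i _ => natAbs_valMinAbs_add_apply_le x y i

omit [NeZero L] in
/-- `1 + |x̃ + ỹ|₁ ≤ (1 + |x̃|₁) + |ỹ|₁` — the unit goes to ONE factor. [cite: FriedliVelenik2017, §10.4] -/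
theorem one_add_momentWt_add_le (x y : TorusSite d L) :
    1 + ∑ i, (((x + y) i).valMinAbs.natAbs : ℝ) ≤ (1 + ∑ i, ((x i).valMinAbs.natAbs : ℝ)) + ∑ i, ((y i).valMinAbs.natAbs : ℝ) := by
  have h := sum_natAbs_valMinAbs_add_le x y
  linarith

/-- **FIRST MOMENT OF A CONVOLUTION (Leibniz form)**: `Σ_x |x̃|₁·‖Σ_y F(y)G(x−y)‖ ≤ M₁(F)·ℓ¹(G) + ℓ¹(F)·M₁(G)`,
`M₁(H) := Σ_x |x̃|₁‖H(x)‖`, `ℓ¹(H) := Σ_x ‖H(x)‖` — no `M₁(F)·M₁(G)` cross term. [cite: BenfattoGiulianiMastropietro2006, §3 (3.3)] -/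
theorem firstMoment_conv_le (F G : TorusSite d L → ℂ) :
    ∑ x, (∑ i, ((x i).valMinAbs.natAbs : ℝ)) * ‖∑ y, F y * G (x - y)‖ ≤
      (∑ x, (∑ i, ((x i).valMinAbs.natAbs : ℝ)) * ‖F x‖) * (∑ x, ‖G x‖) +
        (∑ x, ‖F x‖) * (∑ x, (∑ i, ((x i).valMinAbs.natAbs : ℝ)) * ‖G x‖) :=
  sum_mul_norm_conv_le_of_subadditive momentWt_nonneg sum_natAbs_valMinAbs_add_le F G

/-- **`(1 + |x̃|₁)`-MOMENT OF A CONVOLUTION (Leibniz form)**: `Σ_x (1+|x̃|₁)‖(F∗G)(x)‖ ≤ (Σ_x (1+|x̃|₁)‖F(x)‖)·ℓ¹(G) + ℓ¹(F)·M₁(G)` — the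
second factor contributes its MASS to the first's full weighted norm and only its FIRST MOMENT times the first's mass (contrast the
submultiplicative `sum_mul_norm_conv_le`: `(ℓ¹+M₁)(F)·(ℓ¹+M₁)(G)`). [cite: BenfattoGiulianiMastropietro2006, §3 (3.3)] -/
theorem oneAddMoment_conv_le (F G : TorusSite d L → ℂ) :
    ∑ x, (1 + ∑ i, ((x i).valMinAbs.natAbs : ℝ)) * ‖∑ y, F y * G (x - y)‖ ≤
      (∑ x, (1 + ∑ i, ((x i).valMinAbs.natAbs : ℝ)) * ‖F x‖) * (∑ x, ‖G x‖) +
        (∑ x, ‖F x‖) * (∑ x, (∑ i, ((x i).valMinAbs.natAbs : ℝ)) * ‖G x‖) :=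
  sum_mul_norm_conv_le_of_le_add (fun x => by have := momentWt_nonneg x; positivity) one_add_momentWt_add_le F G

/-- **First moment of a product's inverse transform**: `M₁((fg)ˇ) ≤ M₁(f̌)·ℓ¹(ǧ) + ℓ¹(f̌)·M₁(ǧ)`. [cite: BenfattoGiulianiMastropietro2006, §3 (3.3)] -/
theorem firstMoment_torusFourierInv_mul_le (f g : TorusSite d L → ℂ) :
    ∑ x, (∑ i, ((x i).valMinAbs.natAbs : ℝ)) * ‖torusFourierInv (fun k => f k * g k) x‖ ≤
      (∑ x, (∑ i, ((x i).valMinAbs.natAbs : ℝ)) * ‖torusFourierInv f x‖) * (∑ x, ‖torusFourierInv g x‖) +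
        (∑ x, ‖torusFourierInv f x‖) * (∑ x, (∑ i, ((x i).valMinAbs.natAbs : ℝ)) * ‖torusFourierInv g x‖) :=
  sum_mul_norm_torusFourierInv_mul_le_of_subadditive momentWt_nonneg sum_natAbs_valMinAbs_add_le f g

/-- **`(1 + |x̃|₁)`-moment of a product's inverse transform**: `Σ_x (1+|x̃|₁)‖(fg)ˇ(x)‖ ≤ (Σ(1+|x̃|₁)‖f̌‖)·ℓ¹(ǧ) + ℓ¹(f̌)·M₁(ǧ)`.
[cite: BenfattoGiulianiMastropietro2006, §3 (3.3)] -/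
theorem oneAddMoment_torusFourierInv_mul_le (f g : TorusSite d L → ℂ) :
    ∑ x, (1 + ∑ i, ((x i).valMinAbs.natAbs : ℝ)) * ‖torusFourierInv (fun k => f k * g k) x‖ ≤
      (∑ x, (1 + ∑ i, ((x i).valMinAbs.natAbs : ℝ)) * ‖torusFourierInv f x‖) * (∑ x, ‖torusFourierInv g x‖) +
        (∑ x, ‖torusFourierInv f x‖) * (∑ x, (∑ i, ((x i).valMinAbs.natAbs : ℝ)) * ‖torusFourierInv g x‖) :=
  sum_mul_norm_torusFourierInv_mul_le_of_le_add (fun x => by have := momentWt_nonneg x; positivity) one_add_momentWt_add_le f g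

/-- **Three factors** (iterate): for a subadditive weight, `M_w(F∗G∗H) ≤ M_w(F)ℓ¹(G)ℓ¹(H) + ℓ¹(F)M_w(G)ℓ¹(H) + ℓ¹(F)ℓ¹(G)M_w(H)`, written for
the convolution `x ↦ Σ_y F(y)·(Σ_z G(z)H(x − y − z))` and using `ℓ¹(G∗H) ≤ ℓ¹(G)ℓ¹(H)`. [cite: BenfattoGiulianiMastropietro2006, §3 (3.3)] -/
theorem sum_mul_norm_conv₃_le_of_subadditive {w : TorusSite d L → ℝ} (hw0 : ∀ x, 0 ≤ w x) (hw : ∀ x y, w (x + y) ≤ w x + w y)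
    (F G H : TorusSite d L → ℂ) :
    ∑ x, w x * ‖∑ y, F y * ∑ z, G z * H (x - y - z)‖ ≤
      (∑ x, w x * ‖F x‖) * ((∑ x, ‖G x‖) * (∑ x, ‖H x‖)) +
        (∑ x, ‖F x‖) * ((∑ x, w x * ‖G x‖) * (∑ x, ‖H x‖) + (∑ x, ‖G x‖) * (∑ x, w x * ‖H x‖)) := by
  -- the inner convolution as one function
  set K : TorusSite d L → ℂ := fun u => ∑ z, G z * H (u - z) with hK
  have hrew : (fun x => ∑ y, F y * ∑ z, G z * H (x - y - z)) = fun x => ∑ y, F y * K (x - y) := by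
    funext x; simp only [hK]
  have h1 := sum_mul_norm_conv_le_of_subadditive hw0 hw F K
  simp only [hK] at h1
  refine (le_of_eq (by rfl)).trans (h1.trans ?_)
  -- ℓ¹ and M_w of the inner convolution
  have hl1 : ∑ x, ‖∑ z, G z * H (x - z)‖ ≤ (∑ x, ‖G x‖) * (∑ x, ‖H x‖) := by
    have h := sum_mul_norm_conv_le (w := fun _ => (1 : ℝ)) (fun _ => zero_le_one) (fun _ _ => by norm_num) G H
    simpa using h
  have hMw : ∑ x, w x * ‖∑ z, G z * H (x - z)‖ ≤ (∑ x, w x * ‖G x‖) * (∑ x, ‖H x‖) + (∑ x, ‖G x‖) * (∑ x, w x * ‖H x‖) :=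
    sum_mul_norm_conv_le_of_subadditive hw0 hw G H
  have hF0 : 0 ≤ ∑ x, ‖F x‖ := sum_nonneg fun x _ => norm_nonneg _
  have hFw0 : 0 ≤ ∑ x, w x * ‖F x‖ := sum_nonneg fun x _ => mul_nonneg (hw0 x) (norm_nonneg _)
  exact add_le_add (mul_le_mul_of_nonneg_left hl1 hFw0) (mul_le_mul_of_nonneg_left hMw hF0)


/-! ### §3 The same on ANY finite abelian group (e.g. the space-time grid `(ℤ/N) × (ℤ/L)²` with a weight on the space part only) -/

section AnyGroup

variable {G : Type*} [AddCommGroup G] [Fintype G]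

/-- **Leibniz–Young, two-weight master form, on any finite abelian group**: `0 ≤ w`, `w(x + y) ≤ u(x) + v(y)` give
`Σ_x w(x)‖Σ_y F(y)H(x − y)‖ ≤ (Σ u‖F‖)(Σ ‖H‖) + (Σ ‖F‖)(Σ v‖H‖)` (the grid of the two-leg moment rows is `(ℤ/N) × (ℤ/L)²`, its space
moment weight ignores the time coordinate). [cite: BenfattoGiulianiMastropietro2006, §3 (3.3)] -/
theorem AddCommGroup.sum_mul_norm_conv_le_of_le_add {w u v : G → ℝ} (hw0 : ∀ x, 0 ≤ w x) (hw : ∀ x y, w (x + y) ≤ u x + v y)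
    (F H : G → ℂ) :
    ∑ x, w x * ‖∑ y, F y * H (x - y)‖ ≤
      (∑ x, u x * ‖F x‖) * (∑ x, ‖H x‖) + (∑ x, ‖F x‖) * (∑ x, v x * ‖H x‖) := by
  calc ∑ x, w x * ‖∑ y, F y * H (x - y)‖
      ≤ ∑ x, ∑ y, (u y * ‖F y‖ * ‖H (x - y)‖ + ‖F y‖ * (v (x - y) * ‖H (x - y)‖)) := by
        refine sum_le_sum fun x _ => ?_
        calc w x * ‖∑ y, F y * H (x - y)‖ ≤ w x * ∑ y, ‖F y‖ * ‖H (x - y)‖ :=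
              mul_le_mul_of_nonneg_left ((norm_sum_le _ _).trans (le_of_eq (sum_congr rfl fun y _ => norm_mul _ _))) (hw0 x)
          _ = ∑ y, w x * (‖F y‖ * ‖H (x - y)‖) := by rw [mul_sum]
          _ ≤ ∑ y, (u y * ‖F y‖ * ‖H (x - y)‖ + ‖F y‖ * (v (x - y) * ‖H (x - y)‖)) := sum_le_sum fun y _ => by
              have hxy : w x ≤ u y + v (x - y) := by
                have h := hw y (x - y); rwa [add_sub_cancel] at h
              calc w x * (‖F y‖ * ‖H (x - y)‖) ≤ (u y + v (x - y)) * (‖F y‖ * ‖H (x - y)‖) :=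
                    mul_le_mul_of_nonneg_right hxy (by positivity)
                _ = u y * ‖F y‖ * ‖H (x - y)‖ + ‖F y‖ * (v (x - y) * ‖H (x - y)‖) := by ring
    _ = ∑ y, (u y * ‖F y‖ * ∑ x, ‖H (x - y)‖ + ‖F y‖ * ∑ x, v (x - y) * ‖H (x - y)‖) := by
        rw [sum_comm]
        refine sum_congr rfl fun y _ => ?_
        rw [sum_add_distrib, mul_sum, mul_sum]
    _ = ∑ y, (u y * ‖F y‖ * ∑ x, ‖H x‖ + ‖F y‖ * ∑ x, v x * ‖H x‖) := by
        refine sum_congr rfl fun y _ => ?_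
        congr 2
        · exact Fintype.sum_equiv (Equiv.subRight y) _ _ fun x => rfl
        · exact Fintype.sum_equiv (Equiv.subRight y) _ _ fun x => rfl
    _ = (∑ x, u x * ‖F x‖) * (∑ x, ‖H x‖) + (∑ x, ‖F x‖) * (∑ x, v x * ‖H x‖) := by
        rw [sum_add_distrib, sum_mul, sum_mul]

/-- **Leibniz–Young for a subadditive weight on any finite abelian group**: `M_w(F∗H) ≤ M_w(F)·ℓ¹(H) + ℓ¹(F)·M_w(H)`.
[cite: BenfattoGiulianiMastropietro2006, §3 (3.3)] -/
theorem AddCommGroup.sum_mul_norm_conv_le_of_subadditive {w : G → ℝ} (hw0 : ∀ x, 0 ≤ w x) (hw : ∀ x y, w (x + y) ≤ w x + w y)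
    (F H : G → ℂ) :
    ∑ x, w x * ‖∑ y, F y * H (x - y)‖ ≤
      (∑ x, w x * ‖F x‖) * (∑ x, ‖H x‖) + (∑ x, ‖F x‖) * (∑ x, w x * ‖H x‖) :=
  AddCommGroup.sum_mul_norm_conv_le_of_le_add hw0 hw F H

/-- Plain Young (`ℓ¹(F∗H) ≤ ℓ¹(F)·ℓ¹(H)`) on any finite abelian group — the mass factor the Leibniz forms multiply by. [cite: BenfattoGiulianiMastropietro2006, §3 (3.3)] -/
theorem AddCommGroup.sum_norm_conv_le (F H : G → ℂ) : ∑ x, ‖∑ y, F y * H (x - y)‖ ≤ (∑ x, ‖F x‖) * (∑ x, ‖H x‖) := by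
  have h := AddCommGroup.sum_mul_norm_conv_le_of_le_add (w := fun _ => (1 : ℝ)) (u := fun _ => (1 : ℝ)) (v := fun _ => (0 : ℝ))
    (fun _ => zero_le_one) (fun _ _ => by norm_num) F H
  simpa using h

end AnyGroup

/-! ### §4 The space moment weight on the space-time grid `(ℤ/N) × (ℤ/L)²` -/

section SpaceTime

variable {N : ℕ} {L' : ℕ}

/-- The SPACE first-moment weight of a space-time grid point, `|x̃|₁ := Σ_i |(x.2 i)~|` (time coordinate ignored), is non-negative. [cite: FriedliVelenik2017, §10.4] -/
theorem spaceMomentWt_nonneg (x : ZMod N × TorusSite 2 L') : 0 ≤ ∑ i, (((x.2) i).valMinAbs.natAbs : ℝ) :=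
  sum_nonneg fun _ _ => Nat.cast_nonneg _

/-- The space first-moment weight on the space-time grid is SUBADDITIVE. [cite: FriedliVelenik2017, §10.4] -/
theorem spaceMomentWt_add_le (x y : ZMod N × TorusSite 2 L') :
    ∑ i, ((((x + y).2) i).valMinAbs.natAbs : ℝ) ≤ ∑ i, (((x.2) i).valMinAbs.natAbs : ℝ) + ∑ i, (((y.2) i).valMinAbs.natAbs : ℝ) := by
  rw [Prod.snd_add]
  exact sum_natAbs_valMinAbs_add_le x.2 y.2

/-- `1 + |(x+y)~|₁ ≤ (1 + |x̃|₁) + |ỹ|₁` on the space-time grid. [cite: FriedliVelenik2017, §10.4] -/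
theorem one_add_spaceMomentWt_add_le (x y : ZMod N × TorusSite 2 L') :
    1 + ∑ i, ((((x + y).2) i).valMinAbs.natAbs : ℝ) ≤ (1 + ∑ i, (((x.2) i).valMinAbs.natAbs : ℝ)) + ∑ i, (((y.2) i).valMinAbs.natAbs : ℝ) := by
  have h := spaceMomentWt_add_le x y
  linarith

/-- **FIRST SPACE MOMENT OF A CONVOLUTION ON THE SPACE-TIME GRID (Leibniz form)**: `Σ_x |x̃|₁‖(F∗H)(x)‖ ≤ M₁(F)ℓ¹(H) + ℓ¹(F)M₁(H)`.
[cite: BenfattoGiulianiMastropietro2006, §3 (3.3)] -/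
theorem firstSpaceMoment_conv_le [NeZero N] [NeZero L'] (F H : ZMod N × TorusSite 2 L' → ℂ) :
    ∑ x, (∑ i, (((x.2) i).valMinAbs.natAbs : ℝ)) * ‖∑ y, F y * H (x - y)‖ ≤
      (∑ x, (∑ i, (((x.2) i).valMinAbs.natAbs : ℝ)) * ‖F x‖) * (∑ x, ‖H x‖) +
        (∑ x, ‖F x‖) * (∑ x, (∑ i, (((x.2) i).valMinAbs.natAbs : ℝ)) * ‖H x‖) :=
  AddCommGroup.sum_mul_norm_conv_le_of_subadditive (G := ZMod N × TorusSite 2 L')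
    (w := fun x => ∑ i, (((x.2) i).valMinAbs.natAbs : ℝ)) spaceMomentWt_nonneg spaceMomentWt_add_le F H

/-- **`(1 + |x̃|₁)`-SPACE MOMENT OF A CONVOLUTION ON THE SPACE-TIME GRID (Leibniz form)**:
`Σ_x (1+|x̃|₁)‖(F∗H)(x)‖ ≤ (Σ(1+|x̃|₁)‖F‖)·ℓ¹(H) + ℓ¹(F)·M₁(H)`. [cite: BenfattoGiulianiMastropietro2006, §3 (3.3)] -/
theorem oneAddSpaceMoment_conv_le [NeZero N] [NeZero L'] (F H : ZMod N × TorusSite 2 L' → ℂ) :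
    ∑ x, (1 + ∑ i, (((x.2) i).valMinAbs.natAbs : ℝ)) * ‖∑ y, F y * H (x - y)‖ ≤
      (∑ x, (1 + ∑ i, (((x.2) i).valMinAbs.natAbs : ℝ)) * ‖F x‖) * (∑ x, ‖H x‖) +
        (∑ x, ‖F x‖) * (∑ x, (∑ i, (((x.2) i).valMinAbs.natAbs : ℝ)) * ‖H x‖) :=
  AddCommGroup.sum_mul_norm_conv_le_of_le_add (G := ZMod N × TorusSite 2 L')
    (w := fun x => 1 + ∑ i, (((x.2) i).valMinAbs.natAbs : ℝ)) (u := fun x => 1 + ∑ i, (((x.2) i).valMinAbs.natAbs : ℝ))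
    (v := fun x => ∑ i, (((x.2) i).valMinAbs.natAbs : ℝ))
    (fun x => by have := spaceMomentWt_nonneg x; positivity) one_add_spaceMomentWt_add_le F H

end SpaceTime

end Literature.Probability.LatticeModels

end
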